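import Literature.Geometry.Lorentzian.TwoParameterMaps
import Literature.Geometry.Lorentzian.GeodesicSpeed
import Literature.Geometry.Riemannian.MaximalGeodesicRescaling
import HarnessLib

/-!
# The Gauss lemma (Lee 2018, Thm. 6.9), radial-isometry form

Layer 2 of the programme towards `cutLocus_isClosed_and_mem_of_two_le` (`CutLocusBishop.lean`;
see `CutLocusBishopProofs.lean`, `ExponentialMapSmooth.lean`): the Gauss lemma for the exponential
map `exp_y = expMap g.leviCivita y` of the Levi-Civita connection of a pseudo-Riemannian metric
`g` (`ExponentialMap.lean`), in the form in which it is used to show that radial geodesics are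
locally minimizing (Lee 2018, Thm. 6.9: "`∂_r` is a unit vector field orthogonal to the geodesic
spheres"; equivalently, O'Neill 1983, Ch. 5, Lemma 1 / Gallot–Hulin–Lafontaine 2.93: `exp_y` is a
radial isometry, `⟨d(exp_y)_w(w), d(exp_y)_w(β)⟩ = ⟨w, β⟩`):

* `val_mfderiv_expMap_self` — **radial part**: `g(d(exp_y)_w w, d(exp_y)_w w) = g_y(w, w)`
  (the curve `t ↦ exp_y(t w)` is the geodesic `γ_w`, whose speed is constant, Lee Cor. 5.6);
* `val_mfderiv_expMap_eq_zero_of_val_eq_zero` — **the Gauss lemma**: if `g_y(w, β) = 0` then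
  `g(d(exp_y)_w w, d(exp_y)_w β) = 0`.

Hypotheses: `exp_y` (read on the model vector space `E = T_yM`) is `C^∞` on an open set `S` of
vectors of the domain `𝓔_y`, and `S` contains the thin tube `{t (w + s β) : -ε < t < 1 + ε,
|s| < ε}` around the segment `[0, 1] w` (as every geodesic ball does; see
`NormalNeighbourhoods.exists_geodesicBall`). Proof as printed (Lee, pp. 158–159, (6.7)): for
the two-parameter map `x(t, s) = exp_y(t (w + s β))` each `x(·, s)` is a geodesic
(`isGeodesicOn_expMap_smul`) of constant speed `g_y(w + sβ, w + sβ)`; with `S = ∂_s x`,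
`T = ∂_t x` one has along `s = 0`:
`∂_t g(S, T) = g(D_t S, T) + g(S, D_t T) = g(D_s T, T) + 0 = ½ ∂_s g(T, T) = ½ ∂_s |w + sβ|² = 0`
at `s = 0` (metric compatibility `hasDerivAt_val_apply_along`, the symmetry lemma
`covariantDerivAlong_velocity_comm` of `TwoParameterMaps.lean`, the geodesic equation, and
`g_y(w, β) = 0`); since `S(0, 0) = 0`, `g(S, T)` vanishes identically, and at `t = 1` it is
`g(d(exp_y)_w β, d(exp_y)_w w)`.

No definitions and no named facts are introduced (D-0026).

## References

* J. M. Lee, *Introduction to Riemannian Manifolds*, 2nd ed. (2018), Cor. 5.6, Lemma 6.2,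
  Thm. 6.9 and its proof, (6.7) (pp. 157–159). [LeeRiemannianManifolds2018]
* B. O'Neill, *Semi-Riemannian geometry* (1983), Ch. 5, Lemma 1 (Gauss lemma). [ONeill1983]
-/

noncomputable section

open Bundle Set Filter Function Manifold
open scoped Manifold ContDiff Topology

namespace Literature.Geometry.Riemannian

open Literature.Geometry.Lorentzian
open Literature.Geometry.Lorentzian.PseudoRiemannianMetric

variable {E : Type*} [NormedAddCommGroup E] [NormedSpace ℝ E] {H : Type*} [TopologicalSpace H]
  {I : ModelWithCorners ℝ E H} {M : Type*} [TopologicalSpace M] [ChartedSpace H M]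
  [IsManifold I ∞ M] [FiniteDimensional ℝ E] [CompleteSpace E]

/-! ### Chain rule for velocities through a map of the model vector space -/

omit [IsManifold I ∞ M] [FiniteDimensional ℝ E] [CompleteSpace E] in
/-- Chain rule: the velocity at `t` of `F ∘ c`, for a curve `c` in the model vector space `E` with
derivative `c'` at `t` and `F : E → M` differentiable at `c t`, is `dF_{c t}(c')`. [folklore] -/
theorem velocity_comp_of_hasDerivAt {F : E → M} {c : ℝ → E} {c' v : E} {t : ℝ} (hct : c t = v)
    (hF : MDifferentiableAt 𝓘(ℝ, E) I F v) (hc : HasDerivAt c c' t) :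
    velocity I (F ∘ c) t = mfderiv 𝓘(ℝ, E) I F v c' := by
  subst hct
  have hline : HasMFDerivAt 𝓘(ℝ, ℝ) 𝓘(ℝ, E) c t ((ContinuousLinearMap.id ℝ ℝ).smulRight c') :=
    hasMFDerivAt_iff_hasFDerivAt.2 hc.hasFDerivAt
  have hcomp := hF.hasMFDerivAt.comp t hline
  rw [velocity, hcomp.mfderiv]
  show mfderiv 𝓘(ℝ, E) I F (c t) ((1 : ℝ) • c') = _
  rw [one_smul]

/-! ### The Gauss lemma -/

section Gauss

variable {n : ℕ∞ω} [Fact (1 ≤ n)] (g : PseudoRiemannianMetric I n E (TangentSpace I : M → Type _))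
  [g.HasLeviCivita] [T2Space M] [BoundarylessManifold I M]
  [CovariantDerivative.ContMDiffCovariantDerivative g.leviCivita 1]

/-- **Radial part of the Gauss lemma**: `g(d(exp_y)_w w, d(exp_y)_w w) = g_y(w, w)` whenever
`exp_y` (read on `E = T_yM`) is differentiable at `w ∈ 𝓔_y`: the curve `t ↦ exp_y(t w)` is the
geodesic `γ_w` (Lee Prop. 5.19 (b), `velocity_expMap_smul`), whose velocity at `t = 1` is
`d(exp_y)_w w` by the chain rule, and geodesics have constant speed (Lee Cor. 5.6, the tree's
`val_velocity_eq_of_isGeodesicOn_holds`). [cite: LeeRiemannianManifolds2018, Cor. 5.6 and Prop. 5.19 (b)] -/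
theorem val_mfderiv_expMap_self (y : M) {w : E}
    (hw : (show TangentSpace I y from w) ∈ expDomain g.leviCivita y)
    (hd : MDifferentiableAt 𝓘(ℝ, E) I
      (fun v : E ↦ expMap g.leviCivita y (show TangentSpace I y from v)) w) :
    g.val (expMap g.leviCivita y (show TangentSpace I y from w))
        (mfderiv 𝓘(ℝ, E) I (fun v : E ↦ expMap g.leviCivita y (show TangentSpace I y from v)) w w)
        (mfderiv 𝓘(ℝ, E) I (fun v : E ↦ expMap g.leviCivita y (show TangentSpace I y from v)) w w) =
      g.val y (show TangentSpace I y from w) (show TangentSpace I y from w) := by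
  set F : E → M := fun v ↦ expMap g.leviCivita y (show TangentSpace I y from v) with hF
  have h1 : (1 : ℝ) ∈ maximalGeodesicDomain g.leviCivita y (show TangentSpace I y from w) := by
    rw [mem_maximalGeodesicDomain_iff_smul_mem_expDomain, one_smul]
    exact hw
  obtain ⟨hmax, h0, hx0, hv0⟩ :=
    maximalGeodesic_spec' (cov := g.leviCivita) y (show TangentSpace I y from w)
  -- the velocity of `t ↦ exp_y (t w)` at `1` is `dF_w(w)`
  have hvel : velocity I (fun t : ℝ ↦ F (t • w)) 1 = mfderiv 𝓘(ℝ, E) I F w w := by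
    have hc : HasDerivAt (fun t : ℝ ↦ t • w) w 1 := by
      simpa using (hasDerivAt_id (1 : ℝ)).smul_const w
    exact velocity_comp_of_hasDerivAt (I := I) (one_smul ℝ w) hd hc
  -- and it is the velocity of the geodesic `γ_w` at `1`, of speed `g(w, w)`
  have hvel' : velocity I (fun t : ℝ ↦ F (t • w)) 1 =
      velocity I (maximalGeodesic g.leviCivita y (show TangentSpace I y from w)) 1 :=
    velocity_expMap_smul y (show TangentSpace I y from w) h1
  have hspeed := g.val_velocity_eq_of_isGeodesicOn_holds hmax.isOpen hmax.2.1 hmax.isGeodesicOn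
    h1 h0
  rw [hv0, hx0] at hspeed
  have hpt : F w = maximalGeodesic g.leviCivita y (show TangentSpace I y from w) 1 := by
    have h := (expMap_smul_of_mem (cov := g.leviCivita) y (show TangentSpace I y from w) h1).2
    rwa [one_smul] at h
  -- assemble (all fibres are `E`)
  have key : g.val (F ((fun t : ℝ ↦ t • w) 1)) (velocity I (fun t : ℝ ↦ F (t • w)) 1)
      (velocity I (fun t : ℝ ↦ F (t • w)) 1) =
      g.val y (show TangentSpace I y from w) (show TangentSpace I y from w) := by
    rw [hvel']
    rw [show F ((fun t : ℝ ↦ t • w) 1) = maximalGeodesic g.leviCivita y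
      (show TangentSpace I y from w) 1 by simp only [one_smul]; exact hpt]
    exact hspeed
  rw [hvel] at key
  rw [show (fun t : ℝ ↦ t • w) 1 = w by simp] at key
  exact key

/-- **The Gauss lemma** (Lee 2018, Thm. 6.9; O'Neill 1983, Ch. 5, Lemma 1), radial-isometry
form: let `exp_y` (read on `E = T_yM`) be `C^∞` on an open set `S ⊆ 𝓔_y` containing the tube
`{t (w + s β) : -ε < t < 1 + ε, |s| < ε}`; if `g_y(w, β) = 0` then
`g(d(exp_y)_w w, d(exp_y)_w β) = 0` — the image under `d(exp_y)_w` of a vector `g_y`-orthogonal to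
the radial direction is `g`-orthogonal to the velocity of the radial geodesic. Proof as printed
(Lee, (6.7)), for the two-parameter map `x(t, s) = exp_y(t (w + s β))`: along `s = 0`,
`∂_t g(S, T) = g(D_t S, T) + g(S, D_t T) = g(D_s T, T) = ½ ∂_s g(T, T) = ½ ∂_s g_y(w + sβ, w + sβ) = 0`
(metric compatibility, symmetry lemma, geodesic equation, constant speed, `g_y(w, β) = 0`), and
`g(S, T) = 0` at `t = 0` where `S = 0`. [cite: LeeRiemannianManifolds2018, Thm. 6.9] -/
theorem val_mfderiv_expMap_eq_zero_of_val_eq_zero (y : M) {S : Set E} (hS : IsOpen S)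
    (hF : ContMDiffOn 𝓘(ℝ, E) I ∞
      (fun v : E ↦ expMap g.leviCivita y (show TangentSpace I y from v)) S)
    (hSdom : ∀ v ∈ S, (show TangentSpace I y from v) ∈ expDomain g.leviCivita y)
    {w β : E} {ε : ℝ} (hε : 0 < ε)
    (htube : ∀ t ∈ Ioo (-ε) (1 + ε), ∀ s ∈ Ioo (-ε) ε, t • (w + s • β) ∈ S)
    (hwβ : g.val y (show TangentSpace I y from w) (show TangentSpace I y from β) = 0) :
    g.val (expMap g.leviCivita y (show TangentSpace I y from w))
        (mfderiv 𝓘(ℝ, E) I (fun v : E ↦ expMap g.leviCivita y (show TangentSpace I y from v)) w w)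
        (mfderiv 𝓘(ℝ, E) I (fun v : E ↦ expMap g.leviCivita y (show TangentSpace I y from v)) w β)
      = 0 := by
  set F : E → M := fun v ↦ expMap g.leviCivita y (show TangentSpace I y from v) with hF_def
  have hLC := isLeviCivita_leviCivita_holds (g := g)
  have htor : g.leviCivita.torsion = 0 := hLC.1
  have hcompat : g.IsCompatible g.leviCivita := hLC.2
  -- the two-parameter map `x t s = exp_y (t (w + s β))`
  set vv : ℝ → E := fun s ↦ w + s • β with hvv
  set x : ℝ → ℝ → M := fun t s ↦ F (t • vv s) with hx_def
  have h0I : (0 : ℝ) ∈ Ioo (-ε) ε := ⟨by linarith, hε⟩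
  have hvv0 : vv 0 = w := by simp [hvv]
  -- (a) `x` is `C²` at the points of the tube
  have h2le : (2 : ℕ∞ω) ≤ ∞ := WithTop.coe_le_coe.mpr le_top
  have hψ : ContDiff ℝ ∞ (fun q : ℝ × ℝ ↦ q.1 • (w + q.2 • β)) :=
    contDiff_fst.smul (contDiff_const.add (contDiff_snd.smul contDiff_const))
  have hxC : ∀ t ∈ Ioo (-ε) (1 + ε), ∀ s ∈ Ioo (-ε) ε,
      ContMDiffAt (𝓘(ℝ, ℝ).prod 𝓘(ℝ, ℝ)) I 2 (uncurry x) (t, s) := by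
    intro t ht s hs
    have hq : (fun q : ℝ × ℝ ↦ q.1 • (w + q.2 • β)) (t, s) ∈ S := htube t ht s hs
    have h1 : ContMDiffAt 𝓘(ℝ, E) I ∞ F ((fun q : ℝ × ℝ ↦ q.1 • (w + q.2 • β)) (t, s)) :=
      (hF _ hq).contMDiffAt (hS.mem_nhds hq)
    have h2 : ContMDiffAt 𝓘(ℝ, ℝ × ℝ) 𝓘(ℝ, E) ∞ (fun q : ℝ × ℝ ↦ q.1 • (w + q.2 • β)) (t, s) :=
      (contMDiff_iff_contDiff.2 hψ).contMDiffAt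
    have h3 : ContMDiffAt 𝓘(ℝ, ℝ × ℝ) I 2 (uncurry x) (t, s) := (h1.comp (t, s) h2).of_le h2le
    rw [modelWithCornersSelf_prod, ← chartedSpaceSelf_prod] at h3
    exact h3
  -- (b) the `t`-curves are the geodesics `γ_{w + sβ}`, of constant speed
  have hdom : ∀ s ∈ Ioo (-ε) ε, ∀ t ∈ Ioo (-ε) (1 + ε),
      t ∈ maximalGeodesicDomain g.leviCivita y (show TangentSpace I y from vv s) :=
    fun s hs t ht ↦ (mem_maximalGeodesicDomain_iff_smul_mem_expDomain y _ t).2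
      (hSdom _ (htube t ht s hs))
  have hgeo : ∀ s, IsGeodesicOn g.leviCivita (fun t ↦ x t s)
      (maximalGeodesicDomain g.leviCivita y (show TangentSpace I y from vv s)) :=
    fun s ↦ isGeodesicOn_expMap_smul y (show TangentSpace I y from vv s)
  have hx0 : ∀ s, x 0 s = y := fun s ↦ by
    show expMap g.leviCivita y (show TangentSpace I y from ((0 : ℝ) • vv s)) = y
    rw [zero_smul]
    exact expMap_zero (cov := g.leviCivita) y
  have hspeed : ∀ s ∈ Ioo (-ε) ε, ∀ t ∈ Ioo (-ε) (1 + ε),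
      g.val (x t s) (velocity I (fun t ↦ x t s) t) (velocity I (fun t ↦ x t s) t) =
        g.val y (show TangentSpace I y from vv s) (show TangentSpace I y from vv s) := by
    intro s hs t ht
    obtain ⟨hmax, h0, -, -⟩ :=
      maximalGeodesic_spec' (cov := g.leviCivita) y (show TangentSpace I y from vv s)
    have h := g.val_velocity_eq_of_isGeodesicOn_holds hmax.isOpen hmax.2.1 (hgeo s)
      (hdom s hs t ht) h0
    have hv : velocity I (fun t ↦ x t s) 0 = vv s :=
      velocity_expMap_smul_zero y (show TangentSpace I y from vv s)
    rw [hv, hx0 s] at h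
    exact h
  -- (c) at `s = 0`: `g(D_s T, T) = 0` from the constancy in `s` of `g(T, T) = |w + sβ|²` at `s = 0`
  have hDsT : ∀ t ∈ Ioo (-ε) (1 + ε),
      g.val (x t 0) (covariantDerivAlong g.leviCivita (x t) (fun s ↦ velocity I (fun t ↦ x t s) t) 0)
        (velocity I (fun t ↦ x t 0) t) = 0 := by
    intro t ht
    set DsT := covariantDerivAlong g.leviCivita (x t) (fun s ↦ velocity I (fun t ↦ x t s) t) 0
      with hDsT_def
    have hlift := mdifferentiableAt_lift_velocity_curry_left (hxC t ht 0 h0I)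
    have hder := g.hasDerivAt_val_apply_along hcompat hlift hlift
    -- the same function is the polynomial `s ↦ g_y(w + sβ, w + sβ)` near `0`
    set G : E →L[ℝ] E →L[ℝ] ℝ := g.val y with hG
    have hGsymm : ∀ a c : E, G a c = G c a := fun a c ↦ g.symm y a c
    have hGwβ : G w β = 0 := hwβ
    set P : ℝ → ℝ := fun s ↦ G w w + s * (2 * G w β) + s ^ 2 * G β β with hP
    have hPeq : ∀ s, G (vv s) (vv s) = P s := fun s ↦ by
      simp only [hvv, hP, map_add, map_smul, add_apply, smul_apply, smul_eq_mul]
      rw [hGsymm β w]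
      ring
    have hev : P =ᶠ[𝓝 0] fun s ↦ g.val (x t s) (velocity I (fun t ↦ x t s) t)
        (velocity I (fun t ↦ x t s) t) := by
      filter_upwards [isOpen_Ioo.mem_nhds h0I] with s hs
      rw [hspeed s hs t ht]
      exact (hPeq s).symm
    have hPder : HasDerivAt P 0 0 := by
      have h : HasDerivAt P (0 + 1 * (2 * G w β) + (2 * (0 : ℝ) ^ 1) * G β β) 0 := by
        refine ((hasDerivAt_const _ _).add ((hasDerivAt_id 0).mul_const _)).add ?_
        simpa using (hasDerivAt_pow 2 (0 : ℝ)).mul_const (G β β)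
      rw [hGwβ] at h
      simpa using h
    have hder' := hder.congr_of_eventuallyEq hev
    have huniq := hder'.unique hPder
    rw [g.symm (x t 0) (velocity I (fun t ↦ x t 0) t) DsT] at huniq
    linarith
  -- (d) `f t = g(S, T)(t, 0)` has zero derivative on the tube interval
  set f : ℝ → ℝ := fun t ↦ g.val (x t 0) (velocity I (x t) 0) (velocity I (fun t ↦ x t 0) t)
    with hf_def
  have hfder : ∀ t ∈ Ioo (-ε) (1 + ε), HasDerivAt f 0 t := by
    intro t ht
    have hV := mdifferentiableAt_lift_velocity_curry_right (hxC t ht 0 h0I)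
    have hW : MDifferentiableAt 𝓘(ℝ, ℝ) I.tangent
        (fun t ↦ (TotalSpace.mk' E (x t 0) (velocity I (fun t ↦ x t 0) t) : TangentBundle I M)) t :=
      (hgeo 0).1 t (hdom 0 h0I t ht)
    have hder := g.hasDerivAt_val_apply_along hcompat hV hW
    have hgeq : covariantDerivAlong g.leviCivita (fun t ↦ x t 0)
        (fun t ↦ velocity I (fun t ↦ x t 0) t) t = 0 := (hgeo 0).2 t (hdom 0 h0I t ht)
    have hsymm := covariantDerivAlong_velocity_comm g.leviCivita htor (hxC t ht 0 h0I)
    rw [hgeq, hsymm, hDsT t ht, map_zero, zero_add] at hder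
    exact hder
  -- hence `f 1 = f 0 = 0`
  have hf10 : f 1 = f 0 := by
    refine isOpen_Ioo.is_const_of_deriv_eq_zero (𝕜 := ℝ) isPreconnected_Ioo
      (fun t ht ↦ (hfder t ht).differentiableAt.differentiableWithinAt)
      (fun t ht ↦ (hfder t ht).deriv) ⟨by linarith, by linarith⟩ ⟨by linarith, by linarith⟩
  have hf0 : f 0 = 0 := by
    have hS0 : velocity I (x 0) 0 = 0 := by
      have hfun : x 0 = fun _ ↦ y := funext fun s ↦ hx0 s
      rw [hfun]
      exact velocity_const y 0
    simp only [hf_def, hS0, map_zero, zero_apply]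
  -- (e) identify `f 1`
  have hwS : w ∈ S := by
    have h := htube 1 ⟨by linarith, by linarith⟩ 0 h0I
    rwa [zero_smul, add_zero, one_smul] at h
  have hFd : MDifferentiableAt 𝓘(ℝ, E) I F w :=
    ((hF w hwS).contMDiffAt (hS.mem_nhds hwS)).mdifferentiableAt (by simp)
  have hS1 : velocity I (x 1) 0 = mfderiv 𝓘(ℝ, E) I F w β := by
    have hc : HasDerivAt (fun s : ℝ ↦ (1 : ℝ) • vv s) β 0 := by
      have h : HasDerivAt vv ((1 : ℝ) • β) 0 := by
        simpa [hvv] using ((hasDerivAt_id (0 : ℝ)).smul_const β).const_add w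
      simpa using h.const_smul (1 : ℝ)
    exact velocity_comp_of_hasDerivAt (I := I) (c := fun s : ℝ ↦ (1 : ℝ) • vv s)
      (by rw [one_smul, hvv0]) hFd hc
  have hT1 : velocity I (fun t ↦ x t 0) 1 = mfderiv 𝓘(ℝ, E) I F w w := by
    have hc : HasDerivAt (fun t : ℝ ↦ t • vv 0) w 1 := by
      simpa [hvv0] using (hasDerivAt_id (1 : ℝ)).smul_const (vv 0)
    exact velocity_comp_of_hasDerivAt (I := I) (c := fun t : ℝ ↦ t • vv 0)
      (by rw [one_smul, hvv0]) hFd hc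
  have hpt : x 1 0 = F w := by
    show F ((1 : ℝ) • vv 0) = F w
    rw [one_smul, hvv0]
  have hf1 : f 1 = g.val (F w) (mfderiv 𝓘(ℝ, E) I F w β) (mfderiv 𝓘(ℝ, E) I F w w) := by
    simp only [hf_def]
    rw [hS1, hT1, hpt]
  rw [hf0] at hf10
  rw [hf10] at hf1
  rw [g.symm]
  exact hf1.symm

end Gauss

end Literature.Geometry.Riemannian
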